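import Mathlib

/-!
# Crux `RtdLocal` (stmt-ResolutionOfSingularities-18840), line `Sketch` — stub `stub_pad`

The PAD (UP) move on the route's inline riso-triviality-dimension clauses over
`H := k⟦t^ℚ⟧ = HahnSeries ℚ k` with valuation `v := orderTop`.

For a family of arc coordinates `c : ι → J → H` the three inline clauses are
(1) rv-straightening `∀ a ≠ b, ∃ j, ∀ i, v (c a j - c b j) < v ((φ a i - φ b i) - (c a i - c b i))`,
(2) positivity `0 < v (φ a i)`, and (3) invariance of the straightened family `φ` under translation
by positive vectors of the `H`-span of `C '' W`, for some `W ≤ k^J` of rank `≥ r`.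

If a second block `d : ι → J' → H` is strictly dominated by `c` on distinct arcs, then the
clauses for `c` imply the clauses for the padded family `a ↦ Sum.elim (c a) (d a) : J ⊕ J' → H`
with the same rank: take `W' := W × 0` (the image of `W` under `u ↦ Sum.elim u 0`) and
`φ' a := Sum.elim (φ a) 0`.
* (1): for `a ≠ b` use an index `j₀ : J` minimising `v (c a j - c b j)`; on the old block the
  error term is unchanged, on the new block it is `-(d a i - d b i)`, dominated by assumption.
* (2): the new components of `φ'` vanish, `v 0 = ⊤ > 0`.
* (3): `C '' (W × 0) = (C '' W) × 0`, so a translation vector in its `H`-span is `Sum.elim w 0`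
  with `w` in the `H`-span of `C '' W`; translate `φ` by `w`.
-/

set_option linter.dupNamespace false

namespace Summit.ResolutionOfSingularities.ResolutionOfSingularities.Theorems

/-- **PAD** (stub `stub_pad` of crux `RtdLocal`, line `Sketch`): if the block `d` is strictly
dominated by `c` on distinct arcs, a typed straightener for `c` extends to one for `(c, d)` with
the same `W` (as `W × 0`) and `φ' := (φ, 0)`. -/
theorem stub_pad {k : Type} [Field k] {ι J J' : Type} [Fintype J] [Fintype J']
    (c : ι → J → HahnSeries ℚ k) (d : ι → J' → HahnSeries ℚ k)
    (hdom : ∀ a b, a ≠ b → ∃ j, ∀ i, (c a j - c b j).orderTop < (d a i - d b i).orderTop)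
    (r : ℕ)
    (h : ∃ W : Submodule k (J → k), r ≤ Module.finrank k W ∧
      ∃ φ : ι → J → HahnSeries ℚ k,
        (∀ a b, a ≠ b → ∃ j, ∀ i,
          (c a j - c b j).orderTop < ((φ a i - φ b i) - (c a i - c b i)).orderTop) ∧
        (∀ a i, 0 < (φ a i).orderTop) ∧
        (∀ a (w : J → HahnSeries ℚ k), (∀ i, 0 < (w i).orderTop) →
          w ∈ Submodule.span (HahnSeries ℚ k)
            ((fun u : J → k => fun i => HahnSeries.C (u i)) '' (W : Set (J → k))) →
          ∃ b, φ b = φ a + w)) :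
    ∃ W : Submodule k (J ⊕ J' → k), r ≤ Module.finrank k W ∧
      ∃ φ : ι → J ⊕ J' → HahnSeries ℚ k,
        (∀ a b, a ≠ b → ∃ j, ∀ i,
          (Sum.elim (c a) (d a) j - Sum.elim (c b) (d b) j).orderTop <
            ((φ a i - φ b i) - (Sum.elim (c a) (d a) i - Sum.elim (c b) (d b) i)).orderTop) ∧
        (∀ a i, 0 < (φ a i).orderTop) ∧
        (∀ a (w : J ⊕ J' → HahnSeries ℚ k), (∀ i, 0 < (w i).orderTop) →
          w ∈ Submodule.span (HahnSeries ℚ k)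
            ((fun u : J ⊕ J' → k => fun i => HahnSeries.C (u i)) '' (W : Set (J ⊕ J' → k))) →
          ∃ b, φ b = φ a + w) := by
  obtain ⟨W, hW, φ, h1, h2, h3⟩ := h
  -- the `k`-linear padding `u ↦ (u, 0)` of coefficient vectors
  let E : (J → k) →ₗ[k] (J ⊕ J' → k) :=
    { toFun := fun u => Sum.elim u 0
      map_add' := fun u u' => by
        funext i
        cases i <;> simp
      map_smul' := fun t u => by
        funext i
        cases i <;> simp }
  have hEapp : ∀ u, E u = Sum.elim u 0 := fun u => rfl
  have hE : Function.Injective E := fun u u' huu' => by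
    funext j
    exact congrFun huu' (Sum.inl j)
  -- the `H`-linear padding `x ↦ (x, 0)` of translation vectors
  let EH : (J → HahnSeries ℚ k) →ₗ[HahnSeries ℚ k] (J ⊕ J' → HahnSeries ℚ k) :=
    { toFun := fun x => Sum.elim x 0
      map_add' := fun x x' => by
        funext i
        cases i <;> simp
      map_smul' := fun t x => by
        funext i
        cases i <;> simp }
  have hEHapp : ∀ x, EH x = Sum.elim x 0 := fun x => rfl
  refine ⟨W.map E, ?_, fun a => Sum.elim (φ a) 0, ?_, ?_, ?_⟩
  · -- same rank: `W ≃ W.map E`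
    rw [← (Submodule.equivMapOfInjective E hE W).finrank_eq]
    exact hW
  · -- clause (1): rv-straightening, witnessed by a minimiser of `v (c a j - c b j)`
    intro a b hab
    obtain ⟨j₁, hj₁⟩ := h1 a b hab
    obtain ⟨j₂, hj₂⟩ := hdom a b hab
    obtain ⟨j₀, -, hj₀⟩ := Finset.exists_min_image Finset.univ
      (fun j => (c a j - c b j).orderTop) ⟨j₁, Finset.mem_univ _⟩
    refine ⟨Sum.inl j₀, ?_⟩
    rintro (i | i)
    · simp only [Sum.elim_inl]
      exact (hj₀ j₁ (Finset.mem_univ _)).trans_lt (hj₁ i)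
    · simp only [Sum.elim_inl, Sum.elim_inr, Pi.zero_apply, sub_self, zero_sub,
        HahnSeries.orderTop_neg]
      exact (hj₀ j₂ (Finset.mem_univ _)).trans_lt (hj₂ i)
  · -- clause (2): positivity (the new components vanish)
    rintro a (i | i)
    · exact h2 a i
    · simp only [Sum.elim_inr, Pi.zero_apply, HahnSeries.orderTop_zero]
      exact WithTop.top_pos
  · -- clause (3): translation invariance
    intro a w' hw' hmem
    have hset : ((fun u : J ⊕ J' → k => fun i => HahnSeries.C (u i)) ''
        (W.map E : Set (J ⊕ J' → k))) =
        EH '' ((fun u : J → k => fun i => HahnSeries.C (u i)) '' (W : Set (J → k))) := by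
      rw [Submodule.map_coe, Set.image_image, Set.image_image]
      refine Set.image_congr fun u _ => ?_
      rw [hEHapp, hEapp]
      funext i
      cases i <;> simp
    rw [hset, Submodule.span_image] at hmem
    obtain ⟨w, hw, rfl⟩ := Submodule.mem_map.mp hmem
    obtain ⟨b, hb⟩ := h3 a w (fun i => hw' (Sum.inl i)) hw
    refine ⟨b, ?_⟩
    rw [hEHapp]
    funext i
    cases i with
    | inl j => simp only [Sum.elim_inl, Pi.add_apply, hb]
    | inr j => simp only [Sum.elim_inr, Pi.add_apply, Pi.zero_apply, add_zero]

end Summit.ResolutionOfSingularities.ResolutionOfSingularities.Theorems
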